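/-
Width seat `ym-line-sgb-p1-w3` (seat prover-ym-line-sgb-p1-w3-g0-0), route `SteinGapBootstrap`, crux `GapGivesClusteringG`
(stmt-QuantumFields-22999), line `birth` (planner BC3 skeleton `Cruxes/GapGivesClusteringG/Lines/birth.lean`): registered stub
`stub_polarisationBound`, BY NAME — and the STRONGER form it is derived from (`abs_pairCorr_le_of_rpZero`), which needs reflection
positivity and symmetry of the pair form ONLY AT TIME ZERO (site-plane RP), never at odd times (no bond-plane RP).
-/
import Summits.QuantumFields.YangMills.Theorems.WeakCouplingRatesCalibrationRP
import HarnessLib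

/-!
# Crux `GapGivesClusteringG` (route `SteinGapBootstrap`, rank 3), line `birth`: the registered stub `stub_polarisationBound` — CLOSED,
# via a Cauchy–Schwarz transfer bound that uses reflection positivity at time `0` only

NOT THE CLAY GAP (this serves the RECORD-label rung leaf `WeakCouplingRates.XiPow`, an UPPER bound on the lattice gap; nothing here
bounds a gap from below, and no summit statement is touched).

The crux `Summit.QuantumFields.YangMills.Theses.SteinGapBootstrap.GapGivesClusteringG` asks: for a torus-limit state `μ` with the
DIAGONAL, ONE-SIDED RP-spectral gap `HasRPTimeGap μ m` (`rpCorr μ F t ≤ e^{-mt} rpCorr μ F 0` for positive-time `F`), bound the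
OFF-DIAGONAL pair form `P_t(A,B) = ⟨θA · α_t B⟩_μ − ⟨θA⟩_μ⟨α_t B⟩_μ` by `2 e^{-mt} a b` (`|A| ≤ a`, `|B| ≤ b`).  The planner's skeleton
isolates three stubs: positivity of `rpCorr μ F t` at ALL times (site- and bond-plane reflection positivity of the limit state),
symmetry of `P_t` at all times, and the present functional-analytic step.

MAIN OBSERVATION (this file).  The functional-analytic step needs the first two inputs AT `t = 0` ONLY:
with `C := α_t B` (again a positive-time observable, `|C| ≤ b`), `P_t(A,B) = P_0(A,C)`; site-plane RP (`0 ≤ rpCorr μ F 0 = P_0(F,F)`)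
and symmetry of `P_0` make `P_0` a positive semidefinite symmetric form on positive-time observables, so Cauchy–Schwarz (the
discriminant of `l ↦ P_0(A + lC, A + lC) ≥ 0`) gives `P_0(A,C)² ≤ P_0(A,A) · P_0(C,C)`; translation invariance of torus-limit states
(tree B-TI `integral_comp_configShift_of_mem_limitPoints`) and the geometry `α_t ∘ θ = θ ∘ (shift by t e₀)` give
`P_0(α_t B, α_t B) = rpCorr μ B (2t)`, which the DIAGONAL hypothesis at the EVEN time `2t` bounds by `e^{-2mt} rpCorr μ B 0`; finally
`rpCorr μ F 0 ≤ 2 (sup|F|)²` crudely (no reflection invariance used), whence `|P_t(A,B)| ≤ √(2a² · e^{-2mt} · 2b²) = 2 e^{-mt} a b` —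
exactly the crux's constant.  No positivity at odd times (bond-plane / link reflection positivity), no polarisation and no rescaling are
needed; in transfer-matrix language: `|⟨a, T^t b⟩| ≤ ‖a‖ ‖T^t b‖` and `‖T^t b‖² = ⟨b, T^{2t} b⟩`.

CONTENTS.
* `rpCorr_timeShift_zero` — `rpCorr μ (α_t B) 0 = rpCorr μ B (2t)` for torus-limit states (geometry + B-TI).
* `abs_pairCorr_le_of_rpZero` — the strong form: `μ ∈ infiniteVolumeLimitPoints ρ β`, `0 ≤ rpCorr μ F 0` for positive-time `F`,
  symmetry of `P_0` on positive-time observables, `HasRPTimeGap μ m` ⟹ `|P_t(A,B)| ≤ 2 e^{-mt} a b`.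
* `stub_polarisationBound` — the registered stub of the birth skeleton, LITERALLY (its all-times hypotheses are used at `t = 0` only).

References: K. Osterwalder, E. Seiler, Ann. Phys. 110 (1978) §2 [OsterwalderSeiler1978]; E. Seiler, LNP 159 (1982) Ch. 2 [SeilerLNP1982];
J. Glimm, A. Jaffe, Quantum Physics (1987) §6.1 (transfer matrix contraction bound).
-/

set_option autoImplicit false

noncomputable section

open MeasureTheory Filter
open Literature.MathematicalPhysics
open Summit.QuantumFields.YangMills.Theorems.WeakCouplingRates
open Literature.MathematicalPhysics.QuantumLattice
open Literature.MathematicalPhysics.QuantumFieldTheory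

namespace Summit.QuantumFields.YangMills.Theorems.SteinGapBootstrap

section PairForm

variable {G : Type} [Group G] [TopologicalSpace G] [IsTopologicalGroup G] [CompactSpace G]
  [MeasurableSpace G] [BorelSpace G] {μ : Measure (LGConfig 4 G)}

omit [Group G] [IsTopologicalGroup G] [CompactSpace G] in
/-- Bounded continuous real observables of the `ℤ⁴` gauge field are integrable for a finite measure (second-countable `G`). -/
private theorem integrable_of_continuous_of_bdd [SecondCountableTopology G] [IsFiniteMeasure μ]
    {g : LGConfig 4 G → ℝ} (hc : Continuous g) {C : ℝ} (hC : ∀ U, |g U| ≤ C) : Integrable g μ :=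
  Integrable.of_bound hc.measurable.aestronglyMeasurable C
    (ae_of_all _ fun U => by simpa [Real.norm_eq_abs] using hC U)

omit [Group G] [TopologicalSpace G] [IsTopologicalGroup G] [CompactSpace G] [MeasurableSpace G] [BorelSpace G] in
/-- `|g₁ g₂| ≤ C₁ C₂` from `|g₁| ≤ C₁`, `|g₂| ≤ C₂`. -/
private theorem abs_mul_le_of_abs_le {g₁ g₂ : LGConfig 4 G → ℝ} {C₁ C₂ : ℝ} (h₁ : ∀ U, |g₁ U| ≤ C₁)
    (h₂ : ∀ U, |g₂ U| ≤ C₂) (U : LGConfig 4 G) : |g₁ U * g₂ U| ≤ C₁ * C₂ := by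
  rw [abs_mul]
  exact mul_le_mul (h₁ _) (h₂ _) (abs_nonneg _) ((abs_nonneg (g₁ U)).trans (h₁ U))

omit [TopologicalSpace G] [IsTopologicalGroup G] [CompactSpace G] [BorelSpace G] in
/-- The crude bound `⟨F∘θ · F'⟩ − ⟨F∘θ⟩⟨F'⟩ ≤ 2 C C'` for a probability measure and `|F| ≤ C`, `|F'| ≤ C'` (no measurability and no
reflection invariance are used). -/
private theorem pair_le_two_mul [IsProbabilityMeasure μ] {F F' : LGConfig 4 G → ℝ} {C C' : ℝ}
    (hC : ∀ U, |F U| ≤ C) (hC' : ∀ U, |F' U| ≤ C') :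
    (∫ U, F (timeReflectLG U) * F' U ∂μ) - (∫ U, F (timeReflectLG U) ∂μ) * (∫ U, F' U ∂μ) ≤ 2 * (C * C') := by
  have hC0 : 0 ≤ C := (abs_nonneg _).trans (hC (fun _ => 1))
  have h1 : |∫ U, F (timeReflectLG U) * F' U ∂μ| ≤ C * C' := by
    have hb : ∀ᵐ U ∂μ, ‖F (timeReflectLG U) * F' U‖ ≤ C * C' :=
      ae_of_all _ fun U => by
        rw [Real.norm_eq_abs, abs_mul]
        exact mul_le_mul (hC _) (hC' _) (abs_nonneg _) hC0
    have := norm_integral_le_of_norm_le_const hb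
    rwa [probReal_univ, mul_one, Real.norm_eq_abs] at this
  have h2 : |∫ U, F (timeReflectLG U) ∂μ| ≤ C := by
    have hb : ∀ᵐ U ∂μ, ‖F (timeReflectLG U)‖ ≤ C := ae_of_all _ fun U => by
      rw [Real.norm_eq_abs]; exact hC _
    have := norm_integral_le_of_norm_le_const hb
    rwa [probReal_univ, mul_one, Real.norm_eq_abs] at this
  have h3 : |∫ U, F' U ∂μ| ≤ C' := by
    have hb : ∀ᵐ U ∂μ, ‖F' U‖ ≤ C' := ae_of_all _ fun U => by
      rw [Real.norm_eq_abs]; exact hC' _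
    have := norm_integral_le_of_norm_le_const hb
    rwa [probReal_univ, mul_one, Real.norm_eq_abs] at this
  have h4 : |(∫ U, F (timeReflectLG U) ∂μ) * (∫ U, F' U ∂μ)| ≤ C * C' := by
    rw [abs_mul]
    exact mul_le_mul h2 h3 (abs_nonneg _) hC0
  have h1' := (abs_le.1 h1).2
  have h4' := (abs_le.1 h4).1
  linarith

variable [SecondCountableTopology G] {N : ℕ} (ρ : G →* Matrix (Fin N) (Fin N) ℂ) {β : ℝ}

omit [SecondCountableTopology G] in
/-- **The time-`0` Gram value of a shifted observable is the diagonal correlator at the doubled time**: for a torus-limit state `μ`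
(translation invariant on bounded continuous cylinder observables) and a bounded continuous cylinder observable `B`,
`rpCorr μ (α_t B) 0 = rpCorr μ B (2t)` — from `α_t ∘ θ = θ ∘ (shift by t e₀)`, `α_t = α_{2t} ∘ (shift by t e₀)` and B-TI. -/
theorem rpCorr_timeShift_zero (hμ : μ ∈ infiniteVolumeLimitPoints (d := 4) ρ β) {B : LGConfig 4 G → ℝ}
    {S : Finset (QuantumLattice.ZdEdge 4)} (hBS : IsCylinder B S) (hBc : Continuous B) {b : ℝ} (hb : ∀ U, |B U| ≤ b) (t : ℕ) :
    rpCorr μ (fun U => B (timeShiftLG (G := G) t U)) 0 = rpCorr μ B (2 * t) := by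
  -- geometry: `(α_t B)(θ U) = B(θ (σ U))`, `(α_t B)(U) = (α_{2t} B)(σ U)`, `σ` = shift by `+t e₀`
  have hθ : ∀ U : LGConfig 4 G, B (timeShiftLG (G := G) t (timeReflectLG U)) =
      B (timeReflectLG (configShift (Pi.single 0 (t : ℤ)) U)) := fun U => by
    rw [timeShiftLG_timeReflectLG]
  have hσ : ∀ U : LGConfig 4 G, B (timeShiftLG (G := G) t U) =
      B (timeShiftLG (G := G) (2 * t) (configShift (Pi.single 0 (t : ℤ)) U)) := fun U => by
    rw [two_mul, timeShiftLG_add_configShift_single]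
  -- the three observables whose shifted integrals appear
  obtain ⟨S₁, hS₁⟩ := exists_isCylinder_comp_timeReflectLG (G := G) hBS
  have hcθ : Continuous fun U : LGConfig 4 G => B (timeReflectLG U) := hBc.comp continuous_timeReflectLG
  have hbθ : ∃ C, ∀ U : LGConfig 4 G, |B (timeReflectLG U)| ≤ C := ⟨b, fun U => hb _⟩
  have hS₂ := isCylinder_timeShift hBS (2 * t)
  have hc₂ : Continuous fun U : LGConfig 4 G => B (timeShiftLG (G := G) (2 * t) U) :=
    hBc.comp (continuous_timeShiftLG (2 * t))
  have hb₂ : ∃ C, ∀ U : LGConfig 4 G, |B (timeShiftLG (G := G) (2 * t) U)| ≤ C := ⟨b, fun U => hb _⟩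
  obtain ⟨J, hJ⟩ : ∃ J : LGConfig 4 G → ℝ, ∀ W, J W = B (timeReflectLG W) * B (timeShiftLG (G := G) (2 * t) W) :=
    ⟨_, fun _ => rfl⟩
  have hJfun : J = fun W => B (timeReflectLG W) * B (timeShiftLG (G := G) (2 * t) W) := funext hJ
  have hJS : IsCylinder J _ := hJfun ▸ IsCylinder.mul hS₁ hS₂
  have hJc : Continuous J := hJfun ▸ hcθ.mul hc₂
  have hJb : ∃ C, ∀ W, |J W| ≤ C :=
    ⟨b * b, fun W => by rw [hJ]; exact abs_mul_le_of_abs_le (fun U => hb _) (fun U => hb _) W⟩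
  have i1 : ∫ U, J (configShift (Pi.single 0 (t : ℤ)) U) ∂μ = ∫ U, J U ∂μ :=
    integral_comp_configShift_of_mem_limitPoints ρ hμ _ hJS hJc hJb
  have i2 : ∫ U, B (timeReflectLG (configShift (Pi.single 0 (t : ℤ)) U)) ∂μ = ∫ U, B (timeReflectLG U) ∂μ :=
    integral_comp_configShift_of_mem_limitPoints ρ hμ _ hS₁ hcθ hbθ
  have i3 : ∫ U, B (timeShiftLG (G := G) (2 * t) (configShift (Pi.single 0 (t : ℤ)) U)) ∂μ =
      ∫ U, B (timeShiftLG (G := G) (2 * t) U) ∂μ :=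
    integral_comp_configShift_of_mem_limitPoints ρ hμ _ hS₂ hc₂ hb₂
  have e1 : ∫ U, B (timeShiftLG (G := G) t (timeReflectLG U)) * B (timeShiftLG (G := G) t U) ∂μ =
      ∫ U, B (timeReflectLG U) * B (timeShiftLG (G := G) (2 * t) U) ∂μ := by
    have h : (fun U => B (timeShiftLG (G := G) t (timeReflectLG U)) * B (timeShiftLG (G := G) t U)) =
        fun U => J (configShift (Pi.single 0 (t : ℤ)) U) := by
      funext U; rw [hJ, hθ U, hσ U]
    rw [h, i1]
    simp_rw [hJ]
  have e2 : ∫ U, B (timeShiftLG (G := G) t (timeReflectLG U)) ∂μ = ∫ U, B (timeReflectLG U) ∂μ := by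
    simp_rw [hθ]; exact i2
  have e3 : ∫ U, B (timeShiftLG (G := G) t U) ∂μ = ∫ U, B (timeShiftLG (G := G) (2 * t) U) ∂μ := by
    simp_rw [hσ]; exact i3
  simp only [rpCorr, timeShiftLG_zero]
  rw [e1, e2, e3]

/-- **Off-diagonal clustering from the diagonal RP-spectral gap, using reflection positivity at time `0` only.**  For a torus-limit state
`μ ∈ infiniteVolumeLimitPoints ρ β` (`d = 4`) such that (i) `0 ≤ rpCorr μ F 0` for every positive-time observable `F` (site-plane
reflection positivity) and (ii) the time-`0` pair form is symmetric on positive-time observables (time-reflection invariance), the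
diagonal bound `HasRPTimeGap μ m` gives, for all positive-time `A, B` with `|A| ≤ a`, `|B| ≤ b` and every `t : ℕ`,
`|⟨θA · α_t B⟩ − ⟨θA⟩⟨α_t B⟩| ≤ 2 e^{-mt} a b`.  Proof: Cauchy–Schwarz for the positive semidefinite symmetric form at time `0`
applied to `A` and `α_t B`, `rpCorr μ (α_t B) 0 = rpCorr μ B (2t) ≤ e^{-2mt} rpCorr μ B 0`, and `rpCorr μ F 0 ≤ 2 sup|F|²`.
NOT THE CLAY GAP. -/
theorem abs_pairCorr_le_of_rpZero [IsProbabilityMeasure μ] (hμ : μ ∈ infiniteVolumeLimitPoints (d := 4) ρ β)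
    (hRP : ∀ F : LGConfig 4 G → ℝ, IsPosTimeObs F → 0 ≤ rpCorr μ F 0)
    (hsymm : ∀ (A B : LGConfig 4 G → ℝ), IsPosTimeObs A → IsPosTimeObs B →
      (∫ U, A (timeReflectLG U) * B U ∂μ) - (∫ U, A (timeReflectLG U) ∂μ) * (∫ U, B U ∂μ)
        = (∫ U, B (timeReflectLG U) * A U ∂μ) - (∫ U, B (timeReflectLG U) ∂μ) * (∫ U, A U ∂μ))
    {m : ℝ} (hm : HasRPTimeGap μ m) {A B : LGConfig 4 G → ℝ} (hA : IsPosTimeObs A) (hB : IsPosTimeObs B)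
    {a b : ℝ} (ha : ∀ U, |A U| ≤ a) (hb : ∀ U, |B U| ≤ b) (t : ℕ) :
    |(∫ U, A (timeReflectLG U) * B (timeShiftLG (G := G) t U) ∂μ) -
        (∫ U, A (timeReflectLG U) ∂μ) * (∫ U, B (timeShiftLG (G := G) t U) ∂μ)|
      ≤ 2 * Real.exp (-(m * t)) * a * b := by
  have ha0 : 0 ≤ a := (abs_nonneg _).trans (ha (fun _ => 1))
  have hb0 : 0 ≤ b := (abs_nonneg _).trans (hb (fun _ => 1))
  obtain ⟨SA, hSA, hSApos⟩ := hA.cyl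
  obtain ⟨SB, hSB, hSBpos⟩ := hB.cyl
  -- `C := α_t B` is a positive-time observable with `|C| ≤ b`
  obtain ⟨C, hCdef⟩ : ∃ C : LGConfig 4 G → ℝ, ∀ U, C U = B (timeShiftLG (G := G) t U) := ⟨_, fun _ => rfl⟩
  have hCfun : C = fun U => B (timeShiftLG (G := G) t U) := funext hCdef
  have hCcyl : IsCylinder C (SB.image fun e => (e.1 + Pi.single 0 (t : ℤ), e.2)) :=
    hCfun ▸ isCylinder_timeShift hSB t
  have hCc : Continuous C := hCfun ▸ hB.cont.comp (continuous_timeShiftLG t)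
  have hCb : ∀ U, |C U| ≤ b := fun U => by rw [hCdef]; exact hb _
  have hSCpos : ∀ e : QuantumLattice.ZdEdge 4, e ∈ SB.image (fun e => (e.1 + Pi.single 0 (t : ℤ), e.2)) → 0 ≤ e.1 0 := by
    intro e he
    obtain ⟨e', he', rfl⟩ := Finset.mem_image.1 he
    have := hSBpos e' he'
    simp only [Pi.add_apply, Pi.single_eq_same]
    omega
  have hC : IsPosTimeObs C := ⟨⟨_, hCcyl, hSCpos⟩, hCc, b, hCb⟩
  -- continuity / bounds / integrability of the pieces
  have hθA : Continuous fun U : LGConfig 4 G => A (timeReflectLG U) := hA.cont.comp continuous_timeReflectLG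
  have hθC : Continuous fun U : LGConfig 4 G => C (timeReflectLG U) := hCc.comp continuous_timeReflectLG
  have haθ : ∀ U : LGConfig 4 G, |A (timeReflectLG U)| ≤ a := fun U => ha _
  have hcθ : ∀ U : LGConfig 4 G, |C (timeReflectLG U)| ≤ b := fun U => hCb _
  have iAA : Integrable (fun U => A (timeReflectLG U) * A U) μ :=
    integrable_of_continuous_of_bdd (hθA.mul hA.cont) (abs_mul_le_of_abs_le haθ ha)
  have iAC : Integrable (fun U => A (timeReflectLG U) * C U) μ :=
    integrable_of_continuous_of_bdd (hθA.mul hCc) (abs_mul_le_of_abs_le haθ hCb)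
  have iCA : Integrable (fun U => C (timeReflectLG U) * A U) μ :=
    integrable_of_continuous_of_bdd (hθC.mul hA.cont) (abs_mul_le_of_abs_le hcθ ha)
  have iCC : Integrable (fun U => C (timeReflectLG U) * C U) μ :=
    integrable_of_continuous_of_bdd (hθC.mul hCc) (abs_mul_le_of_abs_le hcθ hCb)
  have iA : Integrable A μ := integrable_of_continuous_of_bdd hA.cont ha
  have iC : Integrable C μ := integrable_of_continuous_of_bdd hCc hCb
  have iθA : Integrable (fun U => A (timeReflectLG U)) μ := integrable_of_continuous_of_bdd hθA haθ
  have iθC : Integrable (fun U => C (timeReflectLG U)) μ := integrable_of_continuous_of_bdd hθC hcθ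
  -- names for the time-zero Gram entries (no `set`: plain equations)
  obtain ⟨pAA, hpAA⟩ : ∃ x : ℝ, x = (∫ U, A (timeReflectLG U) * A U ∂μ) -
      (∫ U, A (timeReflectLG U) ∂μ) * (∫ U, A U ∂μ) := ⟨_, rfl⟩
  obtain ⟨pAC, hpAC⟩ : ∃ x : ℝ, x = (∫ U, A (timeReflectLG U) * C U ∂μ) -
      (∫ U, A (timeReflectLG U) ∂μ) * (∫ U, C U ∂μ) := ⟨_, rfl⟩
  obtain ⟨pCC, hpCC⟩ : ∃ x : ℝ, x = (∫ U, C (timeReflectLG U) * C U ∂μ) -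
      (∫ U, C (timeReflectLG U) ∂μ) * (∫ U, C U ∂μ) := ⟨_, rfl⟩
  have hsy := hsymm A C hA hC
  -- the quadratic `l ↦ rpCorr μ (A + l C) 0 = pAA + 2 l pAC + l² pCC ≥ 0`
  have hquad : ∀ l : ℝ, 0 ≤ pCC * (l * l) + 2 * pAC * l + pAA := by
    intro l
    have hF : IsPosTimeObs (fun U => A U + l * C U) := by
      refine ⟨⟨_, isCylinder_add_smul hSA hCcyl l, fun e he => ?_⟩, hA.cont.add (continuous_const.mul hCc),
        a + |l| * b, fun U => ?_⟩
      · rcases Finset.mem_union.1 he with he | he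
        · exact hSApos e he
        · exact hSCpos e he
      · calc |A U + l * C U| ≤ |A U| + |l * C U| := abs_add_le _ _
          _ ≤ a + |l| * b := by
            rw [abs_mul]; exact add_le_add (ha U) (mul_le_mul_of_nonneg_left (hCb U) (abs_nonneg l))
    have h0 := hRP _ hF
    rw [rpCorr] at h0
    simp only [timeShiftLG_zero] at h0
    have hexp1 : ∫ U, (A (timeReflectLG U) + l * C (timeReflectLG U)) * (A U + l * C U) ∂μ =
        (∫ U, A (timeReflectLG U) * A U ∂μ) + l * (∫ U, A (timeReflectLG U) * C U ∂μ)
          + l * (∫ U, C (timeReflectLG U) * A U ∂μ) + l * l * (∫ U, C (timeReflectLG U) * C U ∂μ) := by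
      have h1 : (fun U => (A (timeReflectLG U) + l * C (timeReflectLG U)) * (A U + l * C U)) =
          fun U => A (timeReflectLG U) * A U + l * (A (timeReflectLG U) * C U)
            + l * (C (timeReflectLG U) * A U) + l * l * (C (timeReflectLG U) * C U) := by
        funext U; ring
      rw [h1, integral_add, integral_add, integral_add, integral_const_mul, integral_const_mul,
        integral_const_mul]
      · exact iAA
      · exact iAC.const_mul l
      · exact iAA.add (iAC.const_mul l)
      · exact iCA.const_mul l
      · exact (iAA.add (iAC.const_mul l)).add (iCA.const_mul l)
      · exact iCC.const_mul (l * l)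
    have hexp2 : ∫ U, (A (timeReflectLG U) + l * C (timeReflectLG U)) ∂μ =
        (∫ U, A (timeReflectLG U) ∂μ) + l * (∫ U, C (timeReflectLG U) ∂μ) := by
      rw [integral_add iθA (iθC.const_mul l), integral_const_mul]
    have hexp3 : ∫ U, (A U + l * C U) ∂μ = (∫ U, A U ∂μ) + l * (∫ U, C U ∂μ) := by
      rw [integral_add iA (iC.const_mul l), integral_const_mul]
    rw [hexp1, hexp2, hexp3] at h0
    have key : pCC * (l * l) + 2 * pAC * l + pAA =
        (∫ U, A (timeReflectLG U) * A U ∂μ) + l * (∫ U, A (timeReflectLG U) * C U ∂μ)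
          + l * (∫ U, C (timeReflectLG U) * A U ∂μ) + l * l * (∫ U, C (timeReflectLG U) * C U ∂μ)
          - ((∫ U, A (timeReflectLG U) ∂μ) + l * (∫ U, C (timeReflectLG U) ∂μ)) *
            ((∫ U, A U ∂μ) + l * (∫ U, C U ∂μ)) := by
      rw [hpCC, hpAC, hpAA]
      linear_combination l * hsy
    rw [key]
    exact h0
  -- Cauchy–Schwarz via the discriminant
  have hCS : pAC * pAC ≤ pAA * pCC := by
    have hd := discrim_le_zero hquad
    rw [discrim] at hd
    nlinarith [hd]
  -- the diagonal entries: `0 ≤ pAA ≤ 2a²`, `0 ≤ pCC = rpCorr μ B (2t) ≤ e^{-2mt} · 2 b²`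
  have hpAA_eq : pAA = rpCorr μ A 0 := by rw [hpAA, rpCorr]; simp only [timeShiftLG_zero]
  have hpCC_eq0 : pCC = rpCorr μ C 0 := by rw [hpCC, rpCorr]; simp only [timeShiftLG_zero]
  have hpCC_eq : pCC = rpCorr μ B (2 * t) := by
    rw [hpCC_eq0, hCfun]
    exact rpCorr_timeShift_zero ρ hμ hSB hB.cont hb t
  have hAA0 : 0 ≤ pAA := by rw [hpAA_eq]; exact hRP A hA
  have hCC0 : 0 ≤ pCC := by rw [hpCC_eq0]; exact hRP C hC
  have hAA_le : pAA ≤ 2 * (a * a) := by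
    rw [hpAA]
    exact pair_le_two_mul ha ha
  have hBB_le : rpCorr μ B 0 ≤ 2 * (b * b) := by
    rw [rpCorr]
    simp only [timeShiftLG_zero]
    exact pair_le_two_mul hb hb
  have hCC_le : pCC ≤ Real.exp (-(m * ↑(2 * t))) * (2 * (b * b)) := by
    rw [hpCC_eq]
    exact (hm.2 B hB (2 * t)).trans (mul_le_mul_of_nonneg_left hBB_le (Real.exp_pos _).le)
  have hexp_sq : Real.exp (-(m * ↑(2 * t))) = Real.exp (-(m * t)) * Real.exp (-(m * t)) := by
    rw [← Real.exp_add]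
    congr 1
    push_cast
    ring
  have hK0 : 0 ≤ 2 * Real.exp (-(m * t)) * a * b := by positivity
  have hsq : pAC * pAC ≤ (2 * Real.exp (-(m * t)) * a * b) * (2 * Real.exp (-(m * t)) * a * b) := by
    calc pAC * pAC ≤ pAA * pCC := hCS
      _ ≤ (2 * (a * a)) * (Real.exp (-(m * ↑(2 * t))) * (2 * (b * b))) :=
          mul_le_mul hAA_le hCC_le hCC0 (by positivity)
      _ = (2 * Real.exp (-(m * t)) * a * b) * (2 * Real.exp (-(m * t)) * a * b) := by rw [hexp_sq]; ring
  have hfinal : |pAC| ≤ 2 * Real.exp (-(m * t)) * a * b :=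
    (mul_self_le_mul_self_iff (abs_nonneg pAC) hK0).2 (by rwa [abs_mul_abs_self])
  rw [hpAC] at hfinal
  simp only [hCdef] at hfinal
  exact hfinal

end PairForm

/-! ### The registered stub of the birth skeleton, by name -/

/-- **Registered stub `stub_polarisationBound` of crux `GapGivesClusteringG` (line `birth`)**, literally: for every compact simple `G`,
faithful unitary `r`, `β`, torus-limit state `μ ∈ infiniteVolumeLimitPoints r.ρ β` whose RP correlator is non-negative at all times and
whose pair form is symmetric at all times, `HasRPTimeGap μ m` gives `|⟨θA · α_t B⟩ − ⟨θA⟩⟨α_t B⟩| ≤ 2 e^{-mt} a b` for positive-time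
`A, B` bounded by `a, b`.  Derived from `abs_pairCorr_le_of_rpZero`, which uses both hypotheses at `t = 0` only.  NOT THE CLAY GAP. -/
theorem stub_polarisationBound :
    ∀ (G : Type) [Group G] [TopologicalSpace G] [IsTopologicalGroup G] [CompactSpace G], IsCompactSimpleLieGroup G →
    letI : MeasurableSpace G := borel G; haveI : BorelSpace G := ⟨rfl⟩;
    ∀ r : LatticeRep G, ∀ β : ℝ, ∀ μ ∈ infiniteVolumeLimitPoints (d := 4) r.ρ β,
    (∀ F : LGConfig 4 G → ℝ, IsPosTimeObs F → ∀ t : ℕ, 0 ≤ rpCorr μ F t) →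
    (∀ (A B : LGConfig 4 G → ℝ), IsPosTimeObs A → IsPosTimeObs B → ∀ t : ℕ,
      (∫ U, A (timeReflectLG U) * B (timeShiftLG (G := G) t U) ∂μ) - (∫ U, A (timeReflectLG U) ∂μ) * (∫ U, B (timeShiftLG (G := G) t U) ∂μ)
        = (∫ U, B (timeReflectLG U) * A (timeShiftLG (G := G) t U) ∂μ) - (∫ U, B (timeReflectLG U) ∂μ) * (∫ U, A (timeShiftLG (G := G) t U) ∂μ)) →
    ∀ m : ℝ, HasRPTimeGap μ m →
    ∀ (A B : LGConfig 4 G → ℝ), IsPosTimeObs A → IsPosTimeObs B → ∀ a b : ℝ, (∀ U, |A U| ≤ a) → (∀ U, |B U| ≤ b) → ∀ t : ℕ,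
      |(∫ U, A (timeReflectLG U) * B (timeShiftLG (G := G) t U) ∂μ) - (∫ U, A (timeReflectLG U) ∂μ) * (∫ U, B (timeShiftLG (G := G) t U) ∂μ)|
        ≤ 2 * Real.exp (-(m * t)) * a * b := by
  intro G _ _ _ _ _ r β μ hμ h₁ h₂ m hm A B hA hB a b ha hb t
  letI : MeasurableSpace G := borel G
  haveI : BorelSpace G := ⟨rfl⟩
  haveI : SecondCountableTopology G :=
    (r.continuous.isClosedEmbedding r.injective).isEmbedding.secondCountableTopology
  haveI : IsProbabilityMeasure μ := by obtain ⟨_, _, hprob, _⟩ := hμ; exact hprob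
  refine abs_pairCorr_le_of_rpZero r.ρ hμ (fun F hF => h₁ F hF 0) (fun A' B' hA' hB' => ?_) hm hA hB ha hb t
  simpa only [timeShiftLG_zero] using h₂ A' B' hA' hB' 0

end Summit.QuantumFields.YangMills.Theorems.SteinGapBootstrap

end
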